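import Summits.CriticalPhenomena.PercolationContinuityZ3.Theorems.PercNearOneGluingNoHeavyLowerTailReduction
import Summits.CriticalPhenomena.PercolationContinuityZ3.Theorems.PercNearOneGluingNoHeavyLowerTailCSHTheoremOne
import HarnessLib

/-!
# `NoHeavyLowerTail` (stmt-CriticalPhenomena-4575) with an EXPLICIT LINEAR modulus `δ(ε) = ε / 4`

Effectivity audit (lane prim-rate, seat audit-3), support file for the closed crux `NoHeavyLowerTail`
(`--supports stmt-CriticalPhenomena-4575`).  No definitions, no named facts, no sorries.

The certified proof `CSH.noHeavyLowerTail_holds` reaches `NoHeavyLowerTail` from `AdditiveGluing` through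
`NearOneGluing`, the many-finger/large-pocket residual and the five-piece cover of
`noHeavyLowerTail_of_manyFingersLargePocket'`, whose `δ` is chosen non-explicitly by continuity at `0`
(`nhlt_exists_delta`).  Once `AdditiveGluing` is known the detour is unnecessary and the modulus is LINEAR:
for a hub `a₀ ∈ A`,
`{1 ≤ N < δ·EN/ε} ⊆ {o ↔ a₀, N < |A|/2} ∪ {o ↮ a₀}`  (as `δ·EN/ε ≤ δ|A|/ε ≤ |A|/2` for `δ ≤ ε/2`);
the first piece has probability `≤ 2δ` by Markov for the number of relays cut from the hub
(`nhlt_hubBlockMarkov`), and additive gluing at `b := a₀` with slack `δ` gives `P(o ↔ a₀) ≥ P(o ↔ A) − δ > 1 − 2δ`,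
so the bad event has probability `< 4δ = ε` at `δ = ε/4`.

* `noHeavyLowerTail_linear_of_additiveGluing` — the explicit-`δ` statement from `AdditiveGluing`;
* `noHeavyLowerTail_linear` — unconditionally (`CSH.additiveGluing_holds`).
(`NoHeavyLowerTail` itself then follows as `fun ε hε => ⟨ε / 4, by positivity, noHeavyLowerTail_linear ε hε⟩`; not restated,
the ∃δ-form being the landed `noHeavyLowerTail_of_additiveGluing` / `CSH.noHeavyLowerTail_holds`.)
[cite: KozmaNitzan2024, Conj. 1 (p. 3), Conj. 3 (p. 15)]
-/

noncomputable section

namespace Summit.CriticalPhenomena.PercolationContinuityZ3.Theorems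

open MeasureTheory Set
open Literature.Probability.LatticeModels (prodBernoulli)
open Literature.Probability.Percolation (openConn BondConfig measurableSet_openConn_holds)
open scoped Classical BigOperators

/-- **`NoHeavyLowerTail` with the explicit linear modulus `δ = ε/4`, from `AdditiveGluing`.**  If
`P(o ↔ A) > 1 − ε/4` and `P(a ↔ a') > 1 − ε/4` for all `a, a' ∈ A`, then
`P(1 ≤ N ∧ N < (ε/4)·EN/ε) < ε`, where `N = #{a ∈ A : o ↔ a}` and `EN = Σ_{a ∈ A} P(o ↔ a)`.
Proof: cover by the hub block `{o ↔ a₀, N < |A|/2}` (Markov, `≤ 2·(ε/4)`) and `{o ↮ a₀}` (additive gluing at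
`b := a₀`, `< 2·(ε/4)`). [cite: KozmaNitzan2024, Conj. 1 (p. 3)] -/
theorem noHeavyLowerTail_linear_of_additiveGluing
    (hA : Summit.CriticalPhenomena.PercolationContinuityZ3.Theses.PercNearOneGluing.AdditiveGluing)
    (ε : ℝ) (hε : 0 < ε) (n : ℕ) (w : Sym2 (Fin n) → unitInterval) (A : Finset (Fin n)) (o : Fin n)
    (hH1 : 1 - ε / 4 < (prodBernoulli w).real (⋃ a ∈ A, openConn o a))
    (hH2 : ∀ a ∈ A, ∀ a' ∈ A, 1 - ε / 4 < (prodBernoulli w).real (openConn a a')) :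
    (prodBernoulli w).real {ω : BondConfig (Fin n) |
        1 ≤ (A.filter fun a => ω ∈ openConn o a).card ∧
        ((A.filter fun a => ω ∈ openConn o a).card : ℝ) <
          ε / 4 * (∑ a ∈ A, (prodBernoulli w).real (openConn o a)) / ε} < ε := by
  set δ : ℝ := ε / 4 with hδ_def
  have hδ0 : 0 < δ := by positivity
  -- empty relay set: the bad event is empty
  rcases A.eq_empty_or_nonempty with hA0 | hAne
  · subst hA0
    simp [hε]
  obtain ⟨a₀, ha₀⟩ := hAne
  have hcard_pos : (0 : ℝ) < A.card := by exact_mod_cast Finset.card_pos.mpr ⟨a₀, ha₀⟩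
  -- the threshold `δ·EN/ε = EN/4 ≤ |A|/4 < |A|/2`
  set EN : ℝ := ∑ a ∈ A, (prodBernoulli w).real (openConn o a) with hEN_def
  have hEN1 : EN ≤ A.card := by
    calc EN ≤ ∑ a ∈ A, (1 : ℝ) := Finset.sum_le_sum fun a _ => measureReal_le_one
      _ = A.card := by simp
  have ht : δ * EN / ε ≤ (A.card : ℝ) / 2 := by
    have h1 : δ * EN / ε = EN / 4 := by
      rw [hδ_def]; field_simp
    rw [h1]
    linarith
  -- star budget at the hub: `P(a ↮ a₀) ≤ δ` for every `a ∈ A`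
  have hstar : ∀ a ∈ A, (prodBernoulli w).real (openConn a a₀)ᶜ ≤ δ := by
    intro a ha
    rw [probReal_compl_eq_one_sub (measurableSet_openConn_holds a a₀)]
    linarith [hH2 a ha a₀ ha₀]
  -- piece 1: the hub block, by Markov (`nhlt_hubBlockMarkov`)
  have hB₁ : (prodBernoulli w).real {ω : BondConfig (Fin n) | ω ∈ openConn o a₀ ∧
      ((A.filter fun a => ω ∈ openConn o a).card : ℝ) < (A.card : ℝ) / 2} ≤ 2 * δ := by
    have h := nhlt_hubBlockMarkov n w A o a₀ ((A.card : ℝ) / 2) (by linarith)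
    have hsum : (∑ a ∈ A, (prodBernoulli w).real (openConn a a₀)ᶜ) ≤ A.card * δ := by
      calc (∑ a ∈ A, (prodBernoulli w).real (openConn a a₀)ᶜ) ≤ ∑ _a ∈ A, δ :=
            Finset.sum_le_sum fun a ha => hstar a ha
        _ = A.card * δ := by simp
    calc (prodBernoulli w).real {ω : BondConfig (Fin n) | ω ∈ openConn o a₀ ∧
          ((A.filter fun a => ω ∈ openConn o a).card : ℝ) < (A.card : ℝ) / 2}
        ≤ (∑ a ∈ A, (prodBernoulli w).real (openConn a a₀)ᶜ) / (A.card - A.card / 2) := h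
      _ ≤ (A.card * δ) / (A.card - A.card / 2) := div_le_div_of_nonneg_right hsum (by linarith)
      _ = 2 * δ := by field_simp; ring
  -- piece 2: `P(o ↮ a₀) < 2δ` by additive gluing at `b := a₀` with slack `δ`
  have hB₂ : (prodBernoulli w).real (openConn o a₀ : Set (BondConfig (Fin n)))ᶜ < 2 * δ := by
    have hglue := hA n w A o a₀ δ hδ0.le (fun a ha => by linarith [hH2 a ha a₀ ha₀])
    rw [probReal_compl_eq_one_sub (measurableSet_openConn_holds o a₀)]
    linarith
  -- the cover
  have hsub : {ω : BondConfig (Fin n) | 1 ≤ (A.filter fun a => ω ∈ openConn o a).card ∧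
      ((A.filter fun a => ω ∈ openConn o a).card : ℝ) < δ * EN / ε} ⊆
      {ω : BondConfig (Fin n) | ω ∈ openConn o a₀ ∧
        ((A.filter fun a => ω ∈ openConn o a).card : ℝ) < (A.card : ℝ) / 2} ∪
      (openConn o a₀ : Set (BondConfig (Fin n)))ᶜ := by
    intro ω hω
    by_cases hoa : ω ∈ openConn o a₀
    · exact Or.inl ⟨hoa, hω.2.trans_le ht⟩
    · exact Or.inr hoa
  calc (prodBernoulli w).real {ω : BondConfig (Fin n) |
          1 ≤ (A.filter fun a => ω ∈ openConn o a).card ∧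
          ((A.filter fun a => ω ∈ openConn o a).card : ℝ) < δ * EN / ε}
      ≤ (prodBernoulli w).real ({ω : BondConfig (Fin n) | ω ∈ openConn o a₀ ∧
          ((A.filter fun a => ω ∈ openConn o a).card : ℝ) < (A.card : ℝ) / 2} ∪
          (openConn o a₀ : Set (BondConfig (Fin n)))ᶜ) := measureReal_mono hsub
    _ ≤ (prodBernoulli w).real {ω : BondConfig (Fin n) | ω ∈ openConn o a₀ ∧
          ((A.filter fun a => ω ∈ openConn o a).card : ℝ) < (A.card : ℝ) / 2} +
        (prodBernoulli w).real (openConn o a₀ : Set (BondConfig (Fin n)))ᶜ := measureReal_union_le _ _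
    _ < 2 * δ + 2 * δ := by linarith
    _ = ε := by rw [hδ_def]; ring

/-- **`NoHeavyLowerTail` with the explicit linear modulus `δ = ε/4`, unconditionally** (via
`CSH.additiveGluing_holds`). [cite: KozmaNitzan2024, Conj. 1 (p. 3)] -/
theorem noHeavyLowerTail_linear (ε : ℝ) (hε : 0 < ε) (n : ℕ) (w : Sym2 (Fin n) → unitInterval)
    (A : Finset (Fin n)) (o : Fin n)
    (hH1 : 1 - ε / 4 < (prodBernoulli w).real (⋃ a ∈ A, openConn o a))
    (hH2 : ∀ a ∈ A, ∀ a' ∈ A, 1 - ε / 4 < (prodBernoulli w).real (openConn a a')) :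
    (prodBernoulli w).real {ω : BondConfig (Fin n) |
        1 ≤ (A.filter fun a => ω ∈ openConn o a).card ∧
        ((A.filter fun a => ω ∈ openConn o a).card : ℝ) <
          ε / 4 * (∑ a ∈ A, (prodBernoulli w).real (openConn o a)) / ε} < ε :=
  noHeavyLowerTail_linear_of_additiveGluing CSH.additiveGluing_holds ε hε n w A o hH1 hH2

/-! ## The linear, `|A|`-uniform lower-tail form with constant `3` (inclusive half threshold)

The docstring of the crux (`Theses/PercNearOneGluing.lean`, item stmt-CriticalPhenomena-4575) conjectures the
LINEAR, `λ`-uniform form `P(1 ≤ N, N ≤ |A|/2) ≤ C·(P(o ↮ A) + max_{a,a'} P(a ↮ a'))`; the tree refutes `C = 1` for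
the inclusive threshold (`linearLowerTailInclusive_cex_five`, ratio `20/19` on five vertices).  From `AdditiveGluing`
the same cover as above gives the form with constant `3` in front of the star budget at any hub `a₀ ∈ A`:
`P(2N ≤ |A|) ≤ P(o ↮ A) + 3·max_{a∈A} P(a ↮ a₀)` — Markov for the relays cut from the hub on `{o ↔ a₀}` (`2·max`)
and additive gluing at `b := a₀` (`P(o ↮ a₀) ≤ P(o ↮ A) + max`).  So the sharp constant of the inclusive linear
form lies in `[20/19, 3]`. -/

/-- **Hub block, inclusive half threshold (Markov).**  On `{o ↔ a₀}` the relays joined to `o` are those joined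
to `a₀`, so `2N ≤ |A|` forces `Y ≥ |A|/2` for `Y = #{a ∈ A : a ↮ a₀}`; Markov's inequality gives
`P(o ↔ a₀, 2N ≤ |A|)·|A| ≤ 2·Σ_{a∈A} P(a ↮ a₀)`. [folklore] -/
theorem nhltlin_hubBlock_inclusive
    (n : ℕ) (w : Sym2 (Fin n) → unitInterval) (A : Finset (Fin n)) (o a₀ : Fin n) :
    (prodBernoulli w).real {ω : BondConfig (Fin n) | ω ∈ openConn o a₀ ∧
        2 * (A.filter fun a => ω ∈ openConn o a).card ≤ A.card} * A.card
      ≤ 2 * ∑ a ∈ A, (prodBernoulli w).real (openConn a a₀)ᶜ := by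
  set μ := prodBernoulli w with hμ
  -- the deficit `Y` = number of relay points cut from the hub, as a sum of indicators
  set Y : BondConfig (Fin n) → ℝ :=
    fun ω => ∑ a ∈ A, ((openConn a a₀ : Set (BondConfig (Fin n)))ᶜ).indicator (fun _ => (1 : ℝ)) ω
    with hY
  have hmeas : ∀ a ∈ A, MeasurableSet ((openConn a a₀ : Set (BondConfig (Fin n)))ᶜ) :=
    fun a _ => (measurableSet_openConn_holds a a₀).compl
  have hint : ∀ a ∈ A, Integrable
      (((openConn a a₀ : Set (BondConfig (Fin n)))ᶜ).indicator (fun _ => (1 : ℝ))) μ :=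
    fun a ha => (integrable_const (1 : ℝ)).indicator (hmeas a ha)
  have hY_int : Integrable Y μ := integrable_finsetSum A hint
  have hY_nonneg : 0 ≤ᵐ[μ] Y := Filter.Eventually.of_forall fun ω =>
    Finset.sum_nonneg fun a _ => Set.indicator_nonneg (fun _ _ => zero_le_one) _
  have hY_integral : ∫ ω, Y ω ∂μ = ∑ a ∈ A, μ.real (openConn a a₀)ᶜ := by
    rw [integral_finsetSum A hint]
    refine Finset.sum_congr rfl fun a ha => ?_
    rw [integral_indicator_const (1 : ℝ) (hmeas a ha), smul_eq_mul, mul_one]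
  -- on the event, `Y = |A| - N ≥ |A|/2`
  have hsub : {ω : BondConfig (Fin n) | ω ∈ openConn o a₀ ∧
      2 * (A.filter fun a => ω ∈ openConn o a).card ≤ A.card} ⊆ {ω | (A.card : ℝ) / 2 ≤ Y ω} := by
    rintro ω ⟨hoa, hN⟩
    have hfilt : (A.filter fun a => ω ∈ openConn o a) = (A.filter fun a => ω ∈ openConn a a₀) := by
      refine Finset.filter_congr fun a _ => ?_
      simp only [openConn, Set.mem_setOf_eq] at hoa ⊢
      exact ⟨fun h => h.symm.trans hoa, fun h => hoa.trans h.symm⟩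
    have hYω : Y ω = (A.card : ℝ) - ((A.filter fun a => ω ∈ openConn a a₀).card : ℝ) := by
      have hterm : ∀ a ∈ A,
          ((openConn a a₀ : Set (BondConfig (Fin n)))ᶜ).indicator (fun _ => (1 : ℝ)) ω
            = 1 - (if ω ∈ openConn a a₀ then (1 : ℝ) else 0) := by
        intro a _
        by_cases h : ω ∈ openConn a a₀ <;> simp [h]
      simp only [hY]
      rw [Finset.sum_congr rfl hterm, Finset.sum_sub_distrib, Finset.sum_const, nsmul_eq_mul,
        mul_one, Finset.sum_boole]
    show (A.card : ℝ) / 2 ≤ Y ω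
    rw [hYω]
    rw [hfilt] at hN
    have h2 : ((2 * (A.filter fun a => ω ∈ openConn a a₀).card : ℕ) : ℝ) ≤ (A.card : ℝ) := by
      exact_mod_cast hN
    push_cast at h2
    linarith
  have hmarkov := mul_meas_ge_le_integral_of_nonneg hY_nonneg hY_int ((A.card : ℝ) / 2)
  rw [hY_integral] at hmarkov
  have hmono : μ.real {ω : BondConfig (Fin n) | ω ∈ openConn o a₀ ∧
      2 * (A.filter fun a => ω ∈ openConn o a).card ≤ A.card} ≤ μ.real {ω | (A.card : ℝ) / 2 ≤ Y ω} :=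
    measureReal_mono hsub
  calc μ.real {ω : BondConfig (Fin n) | ω ∈ openConn o a₀ ∧
          2 * (A.filter fun a => ω ∈ openConn o a).card ≤ A.card} * A.card
      ≤ μ.real {ω | (A.card : ℝ) / 2 ≤ Y ω} * A.card :=
        mul_le_mul_of_nonneg_right hmono (Nat.cast_nonneg _)
    _ = 2 * ((A.card : ℝ) / 2 * μ.real {ω | (A.card : ℝ) / 2 ≤ Y ω}) := by ring
    _ ≤ 2 * ∑ a ∈ A, μ.real (openConn a a₀)ᶜ := by linarith [hmarkov]

/-- **The lower half tail is linearly small, constant `3`, from `AdditiveGluing`.**  For a hub `a₀ ∈ A` with star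
budget `P(a ↮ a₀) ≤ δ₀` (`a ∈ A`): `P(2N ≤ |A|) ≤ P(o ↮ A) + 3δ₀`, `N = #{a ∈ A : o ↔ a}` (no hypothesis on `o`,
uniform in `|A|` and in the weights).  Cover `{2N ≤ |A|} ⊆ {o ↔ a₀, 2N ≤ |A|} ∪ {o ↮ a₀}`; the first piece is
`≤ 2δ₀` (`nhltlin_hubBlock_inclusive`), the second `≤ P(o ↮ A) + δ₀` (additive gluing at `b := a₀`, slack `δ₀`).
[cite: KozmaNitzan2024, Conj. 1 (p. 3)] -/
theorem halfTail_le_of_additiveGluing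
    (hA : Summit.CriticalPhenomena.PercolationContinuityZ3.Theses.PercNearOneGluing.AdditiveGluing)
    (n : ℕ) (w : Sym2 (Fin n) → unitInterval) (A : Finset (Fin n)) (o a₀ : Fin n) (δ₀ : ℝ)
    (ha₀ : a₀ ∈ A) (hδ₀ : ∀ a ∈ A, (prodBernoulli w).real (openConn a a₀)ᶜ ≤ δ₀) :
    (prodBernoulli w).real {ω : BondConfig (Fin n) | 2 * (A.filter fun a => ω ∈ openConn o a).card ≤ A.card}
      ≤ (prodBernoulli w).real (⋃ a ∈ A, openConn o a)ᶜ + 3 * δ₀ := by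
  have hδ₀0 : 0 ≤ δ₀ := le_trans measureReal_nonneg (hδ₀ a₀ ha₀)
  have hcard_pos : (0 : ℝ) < A.card := by exact_mod_cast Finset.card_pos.mpr ⟨a₀, ha₀⟩
  -- piece 1: hub block, `μ(E₁)·|A| ≤ 2 Σ_a P(a ↮ a₀) ≤ 2|A|δ₀`
  have hB₁ : (prodBernoulli w).real {ω : BondConfig (Fin n) | ω ∈ openConn o a₀ ∧
      2 * (A.filter fun a => ω ∈ openConn o a).card ≤ A.card} ≤ 2 * δ₀ := by
    have h := nhltlin_hubBlock_inclusive n w A o a₀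
    have hsum : (∑ a ∈ A, (prodBernoulli w).real (openConn a a₀)ᶜ) ≤ A.card * δ₀ := by
      calc (∑ a ∈ A, (prodBernoulli w).real (openConn a a₀)ᶜ) ≤ ∑ _a ∈ A, δ₀ :=
            Finset.sum_le_sum fun a ha => hδ₀ a ha
        _ = A.card * δ₀ := by simp
    have h2 : (prodBernoulli w).real {ω : BondConfig (Fin n) | ω ∈ openConn o a₀ ∧
        2 * (A.filter fun a => ω ∈ openConn o a).card ≤ A.card} * A.card ≤ (2 * δ₀) * A.card := by
      linarith
    exact le_of_mul_le_mul_right h2 hcard_pos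
  -- piece 2: additive gluing at `b := a₀` with slack `δ₀`
  have hB₂ : (prodBernoulli w).real (openConn o a₀ : Set (BondConfig (Fin n)))ᶜ ≤
      (prodBernoulli w).real (⋃ a ∈ A, openConn o a)ᶜ + δ₀ := by
    have hrel : ∀ a ∈ A, 1 - δ₀ ≤ (prodBernoulli w).real (openConn a a₀) := by
      intro a ha
      have h := hδ₀ a ha
      rw [probReal_compl_eq_one_sub (measurableSet_openConn_holds a a₀)] at h
      linarith
    have hglue := hA n w A o a₀ δ₀ hδ₀0 hrel
    rw [probReal_compl_eq_one_sub (measurableSet_openConn_holds o a₀),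
      probReal_compl_eq_one_sub (Finset.measurableSet_biUnion A fun a _ => measurableSet_openConn_holds o a)]
    linarith
  -- the cover
  have hsub : {ω : BondConfig (Fin n) | 2 * (A.filter fun a => ω ∈ openConn o a).card ≤ A.card} ⊆
      {ω : BondConfig (Fin n) | ω ∈ openConn o a₀ ∧
        2 * (A.filter fun a => ω ∈ openConn o a).card ≤ A.card} ∪
      (openConn o a₀ : Set (BondConfig (Fin n)))ᶜ := by
    intro ω hω
    by_cases hoa : ω ∈ openConn o a₀
    · exact Or.inl ⟨hoa, hω⟩
    · exact Or.inr hoa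
  calc (prodBernoulli w).real {ω : BondConfig (Fin n) | 2 * (A.filter fun a => ω ∈ openConn o a).card ≤ A.card}
      ≤ (prodBernoulli w).real ({ω : BondConfig (Fin n) | ω ∈ openConn o a₀ ∧
          2 * (A.filter fun a => ω ∈ openConn o a).card ≤ A.card} ∪
          (openConn o a₀ : Set (BondConfig (Fin n)))ᶜ) := measureReal_mono hsub
    _ ≤ (prodBernoulli w).real {ω : BondConfig (Fin n) | ω ∈ openConn o a₀ ∧
          2 * (A.filter fun a => ω ∈ openConn o a).card ≤ A.card} +
        (prodBernoulli w).real (openConn o a₀ : Set (BondConfig (Fin n)))ᶜ := measureReal_union_le _ _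
    _ ≤ 2 * δ₀ + ((prodBernoulli w).real (⋃ a ∈ A, openConn o a)ᶜ + δ₀) := add_le_add hB₁ hB₂
    _ = (prodBernoulli w).real (⋃ a ∈ A, openConn o a)ᶜ + 3 * δ₀ := by ring

/-- **The inclusive linear lower-tail form with constant `3`, unconditionally** (the event shape of the certified
negative `linearLowerTailInclusive_cex_five`, which shows that constant `1` fails): for every hub `a₀ ∈ A` and star
budget `δ₀ ≥ max_{a∈A} P(a ↮ a₀)`, `P(1 ≤ N ∧ 2N ≤ |A|) ≤ P(o ↮ A) + 3δ₀`. [cite: KozmaNitzan2024, Conj. 1 (p. 3)] -/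
theorem linearLowerTailInclusive_three
    (n : ℕ) (w : Sym2 (Fin n) → unitInterval) (A : Finset (Fin n)) (o a₀ : Fin n) (δ₀ : ℝ)
    (ha₀ : a₀ ∈ A) (hδ₀ : ∀ a ∈ A, (prodBernoulli w).real (openConn a a₀)ᶜ ≤ δ₀) :
    (prodBernoulli w).real {ω : BondConfig (Fin n) | 1 ≤ (A.filter fun a => ω ∈ openConn o a).card ∧
        2 * (A.filter fun a => ω ∈ openConn o a).card ≤ A.card}
      ≤ (prodBernoulli w).real (⋃ a ∈ A, openConn o a)ᶜ + 3 * δ₀ :=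
  (measureReal_mono (fun _ hω => hω.2)).trans
    (halfTail_le_of_additiveGluing CSH.additiveGluing_holds n w A o a₀ δ₀ ha₀ hδ₀)

end Summit.CriticalPhenomena.PercolationContinuityZ3.Theorems

end
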